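import Summits.ABC.IUTFork.Joshi.ATS1SpacesStructure
import Summits.ABC.IUTFork.Joshi.ATS1PairsCorrespondences
import Summits.ABC.IUTFork.Joshi.ArithTeichmullerSpacePointed
import Summits.ABC.IUTFork.Joshi.ATS1SpacesBasic
import HarnessLib

/-!
# Joshi's ATS I (arXiv:2106.11452v4) §5.8/§5.11/§5.20 over E-t1's POINTED objects — merge-debt companions of slot T-48: Prop. 5.8.1 (2)
# for `ATSObjPointed`, pointed ↦ pairs, and Thm. 5.20.1 in FULL form (topology + `G_E`-action) with the descent to `|𝒳| = |𝒴|/φ^ℤ`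

Block E of the abc-iut cell (rung LADDER-ABC:A2.E; seat abc-iut-E-t21, T-48 companion; items (i)/(iii)/(iv) of the late RE-CUT
07:59Z, left open by the co-typer slot E-t50 — distinct basename so `ATS1SpacesStructure2.lean` stays free). SOURCE: K. Joshi,
arXiv:2106.11452**v4** (UNREFEREED; bib `Joshi2021ATS1`); locators «p.N l.a–b» = PDF page N of the cell's render. TAKES NO SIDE on
[IUTchIII] Cor. 3.12, on Joshi's claims, or on Mochizuki's report; typed ≠ proved; nothing of print asserted. CARRIERS imported BY
NAME: E-t1's `ATSObj`, `UntiltPoints`, `ATSObjPointed` (v4 Def. 5.1.1 pointed objects, p431520: `GeomCompatible`, `geomCompatible_iff`,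
`Rmk512`), E-t10's `ATS1.ArithHolStructure` (§4), this seat's `ATSObj.galoisEquivOfGeomSubgroupEq` (p431517), `ATS1.PairObj`,
`UntiltPoints.XPoints`, `ATS1.Thm5201` (p431643).

WHAT IS HERE. §1 Prop. 5.8.1 (2) on pointed objects: `galoisEquivOfGeomCompatible` (clause (6)(b) `GeomCompatible` ⟹ `G_{E′} ≃ G_E`,
DERIVED) and, under E-t1's typed Rmk. 5.1.2 (`Rmk512`: (6)(b) is automatic), for EVERY pointed object (`nonempty_galoisEquiv_of_rmk512`)
— the printed conclusion of Prop. 5.8.1 (2) with Joshi's own remark as the only hypothesis; the same junction for E-t19's parallel typing `ATSObj.GeomCompatible` / `GeomCompatibleOfAnabelomorphism` (ATS1SpacesBasic p431648: `galoisEquivOfGeomCompatible'`). §2 Def. 5.11.1/5.11.3 junctions: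
`ATSObjPointed.toPair` (forget base point AND label; = `toATSObj ≫ toPair`), E-t10's structures on `X` give pairs over the base
(`ArithHolStructure.toPair_mem_overBase`). §3 §5.20 DERIVED: a bijection of degree-one points commuting with Frobenius commutes with
all its INTEGER powers (`semiconj_zpow`) and hence DESCENDS to a bijection `|𝒳_{F,E}| ≃ |𝒳_{F,E′}|` of the Frobenius-orbit quotients
(`xPointsEquiv`) — the second display of Thm. 5.20.1 from the first, at bijection level. §4 Thm. 5.20.1 in FULL printed form as a claim
over an explicit signature `ATS1.PointsTopGal` adding what E-t1's `UntiltPoints` lacks (a topology on `|𝒴_{F,E}|` and a `G_E`-action;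
merge-debt E-t1): `Thm5201Full` — «any anabelomorphism `α : G_E ≃ G_{E′}` (topological) induces a HOMEOMORPHISM `|𝒴_{F,E}| ≃ |𝒴_{F,E′}|`
compatible with the group actions» (p.33 l.34–39), with Frobenius-compatibility so that `|𝒳|` follows by §3; `thm5201_of_full`
recovers the weak shell of p431643. Standard axioms only; sorry-free.
-/

noncomputable section

open Set

namespace Summit.ABC.IUTFork.Joshi

open Literature.AnabelianGeometry.SemiGraphs (TemperedCurve)

variable {p : ℕ} [Fact p.Prime]

/-! ## 1. Prop. 5.8.1 (2) on E-t1's pointed objects -/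

namespace ATSObjPointed

variable {X : TemperedCurve p} {𝔅 : ∀ Y : TemperedCurve p, ATS1.BerkovichDatum Y} {F : Type} [NormedField F]
  [CompleteSpace F] [IsUltrametricDist F] [IsAlgClosed F] [CharP F p]

/-- **Prop. 5.8.1 (2) for a pointed object** ([J-I] p.29 l.10–23 «any anabelomorphism `Π^temp_{Y/E′} ≃ Π^temp_{X/E}` provides an
anabelomorphism `G_{E′} ≃ G_E`»): clause (6)(b) of Def. 5.1.1 (`GeomCompatible`, E-t1) is exactly the input of
`ATSObj.galoisEquivOfGeomSubgroupEq` (E-t1's `geomCompatible_iff`). DERIVED. [folklore] -/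
def galoisEquivOfGeomCompatible (A : ATSObjPointed X 𝔅 F) (h : A.GeomCompatible) : A.Y.GK ≃* X.GK :=
  ATSObj.galoisEquivOfGeomSubgroupEq A.toATSObj ((geomCompatible_iff A).1 h)

variable (X 𝔅 F) in
/-- Under E-t1's typed Rmk. 5.1.2 (`Rmk512`: «(6)(b) is automatic»), EVERY pointed object of `𝔍(X,E)` has base field anabelomorphic to
`E` — the printed conclusion of Prop. 5.8.1 (2), DERIVED with Joshi's own remark as the only hypothesis. [folklore] -/
theorem nonempty_galoisEquiv_of_rmk512 (h : Rmk512 X 𝔅 F) (A : ATSObjPointed X 𝔅 F) : Nonempty (A.Y.GK ≃* X.GK) :=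
  ⟨galoisEquivOfGeomCompatible A (h A)⟩

/-! ## 2. Def. 5.11.1 / 5.11.3 junctions: pointed objects and E-t10's structures ↦ pairs -/

/-- Forget base point, tilt datum AND label: a pointed object (v4 Def. 5.1.1) gives a PAIR (v4 Def. 5.11.1) — Prop. 5.11.2 (1) composed
with E-t1's `toATSObj`. [folklore] -/
def toPair (A : ATSObjPointed X 𝔅 F) : ATS1.PairObj X := A.toATSObj.toPair

/-- The pair of a pointed object has the object's curve. [folklore] -/
theorem toPair_Y (A : ATSObjPointed X 𝔅 F) : A.toPair.Y = A.Y := rfl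

/-- Relabelling a pointed object does not change its pair. [folklore] -/
theorem toPair_relabel (σ : X.PiTemp ≃ₜ* X.PiTemp) (A : ATSObjPointed X 𝔅 F) : (relabel σ A).toPair = A.toPair := rfl

end ATSObjPointed

namespace ATSObj

variable {X : TemperedCurve p}

/-- **Junction with E-t19's typing of Def. 5.1.1 (6)(b)** (`ATSObj.GeomCompatible`, ATS1SpacesBasic p431648; Rmk. 5.1.2 =
`GeomCompatibleOfAnabelomorphism`): their predicate feeds this seat's Prop. 5.8.1 (2) derivation, strengthening E-t19's
`prop551_2_gal` (isomorphic quotients `Π^temp/Δ^temp`) to the printed «`G_{E′} ≃ G_E`» as subgroups of `G_{ℚ_p}`. DERIVED. [folklore] -/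
def galoisEquivOfGeomCompatible' (A : ATSObj X) (h : A.GeomCompatible) : A.Y.GK ≃* X.GK :=
  galoisEquivOfGeomSubgroupEq A ((geomCompatible_iff A).1 h)

/-- Under Rmk. 5.1.2 in E-t19's form, every object of `𝔍(X,E)` has base field anabelomorphic to `E` (Prop. 5.5.1 (2) / Prop. 5.8.1 (2),
printed conclusion). DERIVED modulo the claim. [folklore] -/
theorem nonempty_galoisEquiv_of_geomCompatibleOfAnabelomorphism (hX : GeomCompatibleOfAnabelomorphism X) (A : ATSObj X) :
    Nonempty (A.Y.GK ≃* X.GK) :=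
  ⟨galoisEquivOfGeomCompatible' A (hX A)⟩

end ATSObj

namespace ATS1.ArithHolStructure

variable {X : TemperedCurve p} {𝔄 : ATS1.BerkovichDatum X} {F : Type} [NormedField F] [CompleteSpace F] [IsUltrametricDist F]
  [IsAlgClosed F] [CharP F p]

/-- E-t10's arithmetic holomorphic structure on `X/E` itself (§4) gives a pair (Def. 5.11.1) via its object `(X/E, E ↪ K, id)`. [folklore] -/
def toPair (S : ATS1.ArithHolStructure X 𝔄 F) : ATS1.PairObj X := S.toATSObj.toPair

/-- … lying in `𝔍(X,E)_E` (Def. 5.11.3 (2): base field `E` itself). [folklore] -/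
theorem toPair_mem_overBase (S : ATS1.ArithHolStructure X 𝔄 F) : S.toPair ∈ ATS1.PairObj.overBase X := rfl

end ATS1.ArithHolStructure

/-! ## 3. §5.20 DERIVED: a Frobenius-compatible bijection of `|𝒴|` descends to `|𝒳| = |𝒴|/φ^ℤ` -/

section Descent

variable {α β : Type*}

/-- If `e ∘ F = G ∘ e` for permutations `F`, `G`, then also `e ∘ F⁻¹ = G⁻¹ ∘ e`. [folklore] -/
theorem semiconj_symm (e : α ≃ β) (F : Equiv.Perm α) (G : Equiv.Perm β) (h : ∀ y, e (F y) = G (e y)) (y : α) :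
    e (F.symm y) = G.symm (e y) := by
  apply G.injective
  rw [Equiv.apply_symm_apply, ← h, Equiv.apply_symm_apply]

/-- If `e ∘ F = G ∘ e` then `e ∘ F^n = G^n ∘ e` for every INTEGER `n`. [folklore] -/
theorem semiconj_zpow (e : α ≃ β) (F : Equiv.Perm α) (G : Equiv.Perm β) (h : ∀ y, e (F y) = G (e y)) :
    ∀ (n : ℤ) (y : α), e ((F ^ n) y) = (G ^ n) (e y)
  | (n : ℕ), y => by
      rw [zpow_natCast, zpow_natCast, Equiv.Perm.coe_pow, Equiv.Perm.coe_pow]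
      exact Function.Semiconj.iterate_right h n y
  | Int.negSucc n, y => by
      rw [zpow_negSucc, zpow_negSucc, Equiv.Perm.inv_def, Equiv.Perm.inv_def]
      refine semiconj_symm e (F ^ (n + 1)) (G ^ (n + 1)) (fun z => ?_) y
      rw [Equiv.Perm.coe_pow, Equiv.Perm.coe_pow]
      exact Function.Semiconj.iterate_right h (n + 1) z

end Descent

namespace UntiltPoints

variable {𝒪E 𝒪E' : Type} [CommRing 𝒪E] [CommRing 𝒪E'] (D : UntiltPoints p 𝒪E) (D' : UntiltPoints p 𝒪E')

/-- Two points in the same Frobenius orbit differ by an integer power of `φ`. [folklore] -/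
theorem frobSetoid_iff (a b : D.Pt) : D.frobSetoid a b ↔ ∃ n : ℤ, (D.frob ^ n) b = a := by
  show MulAction.orbitRel (Subgroup.zpowers D.frob) D.Pt a b ↔ _
  rw [MulAction.orbitRel_apply, MulAction.mem_orbit_iff]
  constructor
  · rintro ⟨⟨g, hg⟩, rfl⟩
    obtain ⟨n, rfl⟩ := Subgroup.mem_zpowers_iff.1 hg
    exact ⟨n, rfl⟩
  · rintro ⟨n, rfl⟩
    exact ⟨⟨D.frob ^ n, Subgroup.mem_zpowers_iff.2 ⟨n, rfl⟩⟩, rfl⟩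

/-- **Descent to `|𝒳|`**: a bijection of degree-one points commuting with Frobenius induces a map `|𝒳_{F,E}| → |𝒳_{F,E′}|` on the
orbit quotients (the second display of Thm. 5.20.1 from the first, p.33 l.36–39). DERIVED. [folklore] -/
def xPointsMap (e : D.Pt ≃ D'.Pt) (he : ∀ y, e (D.frob y) = D'.frob (e y)) : D.XPoints → D'.XPoints :=
  Quotient.lift (fun y => D'.toXPoint (e y)) fun a b hab => by
    obtain ⟨n, rfl⟩ := (D.frobSetoid_iff a b).1 hab
    apply Quotient.sound
    exact (D'.frobSetoid_iff _ _).2 ⟨n, (semiconj_zpow e D.frob D'.frob he n b).symm⟩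

/-- The descended map on classes of points. [folklore] -/
theorem xPointsMap_toXPoint (e : D.Pt ≃ D'.Pt) (he : ∀ y, e (D.frob y) = D'.frob (e y)) (y : D.Pt) :
    D.xPointsMap D' e he (D.toXPoint y) = D'.toXPoint (e y) := rfl

/-- The inverse bijection commutes with Frobenius too. [folklore] -/
theorem symm_frob_comm (e : D.Pt ≃ D'.Pt) (he : ∀ y, e (D.frob y) = D'.frob (e y)) (y : D'.Pt) :
    e.symm (D'.frob y) = D.frob (e.symm y) := by
  apply e.injective
  rw [Equiv.apply_symm_apply, he, Equiv.apply_symm_apply]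

/-- **`|𝒳_{F,E}| ≃ |𝒳_{F,E′}|` from a Frobenius-compatible `|𝒴_{F,E}| ≃ |𝒴_{F,E′}|`** (Thm. 5.20.1, second display, at bijection
level). DERIVED. [folklore] -/
def xPointsEquiv (e : D.Pt ≃ D'.Pt) (he : ∀ y, e (D.frob y) = D'.frob (e y)) : D.XPoints ≃ D'.XPoints where
  toFun := D.xPointsMap D' e he
  invFun := D'.xPointsMap D e.symm (D.symm_frob_comm D' e he)
  left_inv c := by
    induction c using Quotient.ind with
    | _ y => show D.toXPoint (e.symm (e y)) = D.toXPoint y; rw [Equiv.symm_apply_apply]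
  right_inv c := by
    induction c using Quotient.ind with
    | _ y => show D'.toXPoint (e (e.symm y)) = D'.toXPoint y; rw [Equiv.apply_symm_apply]

end UntiltPoints

/-! ## 4. Thm. 5.20.1 in full printed form (topology + `G_E`-action), over an explicit signature -/

namespace ATS1

/-- **The data Thm. 5.20.1 speaks about and E-t1's `UntiltPoints` does not carry** (merge-debt E-t1): a topology on `|𝒴_{F,E}|`
(«homeomorphism of topological spaces», p.33 l.36) and the action of `G_E` («compatible with the respective topological group
actions `G_E ↷ |𝒴_{F,E}|`», p.33 l.36–37), `G_E = E.fixingSubgroup ≤ G_{ℚ_p}` for the base field `E ⊆ Q̄_p`, commuting with Frobenius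
(so that it passes to `|𝒳_{F,E}|`, (5.20.3)). SIGNATURE; nothing about the Fargues–Fontaine curve is built in. [claim: Joshi2021ATS1, status: disputed] -/
@[claim "Joshi2021ATS1" "disputed"]
structure PointsTopGal (E : IntermediateField ℚ_[p] (AlgebraicClosure ℚ_[p])) {𝒪E : Type} [CommRing 𝒪E] (D : UntiltPoints p 𝒪E) :
    Type where
  /-- the topology of `|𝒴_{F,E}|` -/
  top : TopologicalSpace D.Pt
  /-- the action `G_E ↷ |𝒴_{F,E}|` -/
  act : ↥E.fixingSubgroup →* Equiv.Perm D.Pt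
  /-- the action commutes with Frobenius -/
  act_frob : ∀ g y, act g (D.frob y) = D.frob (act g y)

/-- CLAIM **Thm. 5.20.1, FULL printed form** (J1:Thm5.20.1, p.33 l.34–39: «any anabelomorphism `α : G_E → G_{E′}` induces a
homeomorphism of topological spaces compatible with the respective topological group actions `G_E ↷ |𝒴_{F,E}| ≃ |𝒴_{F,E′}| ↶ G_{E′}`
and `G_E ↷ |𝒳_{F,E}| ≃ |𝒳_{F,E′}| ↶ G_{E′}`»), over the signature `PointsTopGal` for `E` and `E′`: for every TOPOLOGICAL isomorphism
`α` of the absolute Galois groups there is a Frobenius-compatible, `α`-EQUIVARIANT homeomorphism of the degree-one points (the `|𝒳|`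
statement then follows by `UntiltPoints.xPointsEquiv`). HYPOTHESIS, never asserted. [claim: Joshi2021ATS1, status: disputed] -/
@[claim "Joshi2021ATS1" "disputed"]
def Thm5201Full (E E' : IntermediateField ℚ_[p] (AlgebraicClosure ℚ_[p])) {𝒪E 𝒪E' : Type} [CommRing 𝒪E] [CommRing 𝒪E']
    {D : UntiltPoints p 𝒪E} {D' : UntiltPoints p 𝒪E'} (T : PointsTopGal E D) (T' : PointsTopGal E' D') : Prop :=
  letI := T.top; letI := T'.top
  ∀ α : ↥E.fixingSubgroup ≃ₜ* ↥E'.fixingSubgroup,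
    ∃ e : D.Pt ≃ₜ D'.Pt,
      (∀ y, e (D.frob y) = D'.frob (e y)) ∧ ∀ (g : ↥E.fixingSubgroup) (y : D.Pt), e (T.act g y) = T'.act (α g) (e y)

/-- The full form implies the weak shell of p431643 (`Thm5201`: a Frobenius-compatible bijection from an isomorphism of Galois groups)
whenever the given isomorphism is topological. [folklore] -/
theorem exists_equiv_of_thm5201Full {E E' : IntermediateField ℚ_[p] (AlgebraicClosure ℚ_[p])} {𝒪E 𝒪E' : Type} [CommRing 𝒪E]
    [CommRing 𝒪E'] {D : UntiltPoints p 𝒪E} {D' : UntiltPoints p 𝒪E'} {T : PointsTopGal E D} {T' : PointsTopGal E' D'}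
    (h : Thm5201Full E E' T T') (α : ↥E.fixingSubgroup ≃ₜ* ↥E'.fixingSubgroup) :
    ∃ e : D.Pt ≃ D'.Pt, (∀ y, e (D.frob y) = D'.frob (e y)) ∧ Nonempty (D.XPoints ≃ D'.XPoints) := by
  letI := T.top; letI := T'.top
  obtain ⟨e, he, -⟩ := h α
  exact ⟨e.toEquiv, he, ⟨D.xPointsEquiv D' e.toEquiv he⟩⟩

end ATS1

end Summit.ABC.IUTFork.Joshi

end
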